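import Summits.QuantumFields.BalabanUV.T4Continuum.Support.RegionGaugeFixedVectorFlat
import Summits.QuantumFields.BalabanUV.T4Continuum.Support.DirichletRegionTower
import Literature.MathematicalPhysics.QuantumFieldTheory.Balaban1983to89.B5DeltaA169
import Literature.MathematicalPhysics.QuantumFieldTheory.Balaban1983to89.B5DivOrth

/-!
# T⁴ programme, spine node NE2 (U1a), sub-row Δ1 «NE2⁰-Dirichlet» — THE ⊤-WITNESS OF THE SLICE INEQUALITY:
# on the WHOLE TORUS Bałaban's slice coercivity `SliceCoercive` HOLDS with B5's constant `γ_D`, uniformly in `η` and the torus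

NE2 formalisation swarm `b2b-balaban-t4-ne2-formalise-*`, leaf 07 (gen 6), supplier item «Δ1-COERC» (owner ruling R23 (a), journal
2026-08-20 l.15836), file 5.  Files 1–4 (gen 5): `Support/RegionGaugeSlice` (the reduction «`Δ_a(Ω₀)` coercive ⟺ ONE slice inequality
`SliceCoercive`»), `Support/RegionScalarCompression`, `Support/RegionGaugeFixedVector` (THE [B9]-faithful `U = 1` region vector operator
`regionDeltaA` on the STAR bonds, `sliceData_region`), `Support/RegionGaugeFixedVectorFlat` («`G(Ω₀)` exists» for every region).  The
ONE displayed analytic input of the vector layer's W1 (owner O13-a, journal l.16321) is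
`SliceCoercive (curlR n M S) (gradR n M S) (GOm n M a′ S) (QOm n M S) (avgR n M S) (a·n^d) c` — «the gauge-INVARIANT form
`‖curl A‖² + a n^d‖QA‖²` is `c`-coercive on Bałaban's slice `{R(Ω₀)·∂_Ω*A = 0}`», located open estimate `t4/T4-EST-NE2-D1-COERC.md` §6.

WHAT THIS FILE PROVES (0 sorry): the inequality is NON-VACUOUS and CONSISTENT — at `S = ⊤` (the whole torus as one region) it HOLDS with
the `n`-, `M`-uniform constant `γ_D = ((d+1)·Cst(d,a))⁻¹` of the tree's kernel version of [Balaban1984PropagatorsI] Prop. 1.1 (1.90)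
(`DirichletRegionTower.coercive_calDa`).  The mechanism is B5 p. 30 (1.69)/(1.70) read on the slice: «⟨A, Δ_a A⟩ = ⟨A, ∂*∂A⟩ + ⟨A, ∂R∂*A⟩ +
a⟨A, Q*QA⟩ … R = I − P … The configuration ∂*A is orthogonal to constant functions and on such configurations the operator P is given by
the formula P = Δ⁻¹Q′*(Q′Δ⁻²Q′*)⁻¹Q′Δ⁻¹» — on Bałaban's slice OF THE WHOLE TORUS the divergence `∂*A` lies in `G′·range Q′*`, its Laplacian
is therefore in `range Q′*`, and B5's `P` (tree: `B5Value126.PcT`) FIXES every mean-zero scalar whose Laplacian is in `range Q′*`; so the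
middle term of (1.69) vanishes on the slice and (1.90) IS slice coercivity.

 * §1 generic bookkeeping: restriction / extension along an everywhere-true predicate.
 * §2 THE KEY TORUS LEMMA **`PcT_mulVec_eq_self`**: `f ⊥ 1`, `Δf = Q′ᴴν` ⟹ `P f = f` (`LapSinv_LapS_of_orth`, `sum_QsOp_adjoint`,
   `Minv_Mop_of_orth` of the B5 modules BY NAME), and the slice algebra **`eq_G_QH_of_gaugeR_eq_zero`**: `R·f = 0 ⟹ f = G′Q′ᴴμ`.
 * §3 the region objects at `S = ⊤` versus the torus objects: `curlR`/`avgR`/`gradRᴴ` act on the zero-extension `ιA′` as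
   `2^{−1/2}·Curl`, `Q` (gen 5's `RegionGaugeFixedVectorFlat.avgR_mulVec` BY NAME), `∂ᴴ`; **`PcT_ext_eq_self_of_gaugeR_eq_zero`**: a
   mean-zero scalar killed by `R(⊤)` is FIXED by `P`; **`PcT_divergence_top`**: on the slice of the whole torus `P(∂ᴴιA′) = ∂ᴴιA′`; **`re_form_DeltaA_of_PcT`**:
   then `Re⟨ιA′, Δ_a ιA′⟩ = ½‖Curl ιA′‖² + a n^d‖Q ιA′‖²` (`B5DeltaA169.DeltaA_eq_curl`).
 * §4 END **`sliceCoercive_top (hn : 1 ≤ n) (ha : 0 < a) (ha′ : 0 < a′) :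
   SliceCoercive (curlR n M ⊤) (gradR n M ⊤) (GOm n M a′ ⊤) (QOm n M ⊤) (avgR n M ⊤) (a·n^d) (gamD d a)`**, and through gen 5's reduction
   BY NAME **`coercive_regionDeltaA_top`** / **`opNorm_inv_regionDeltaA_top_le`**: the faithful region operator of the whole torus is
   coercive with `min(γ_D/2, γ′/2)`, `‖G(⊤)‖ ≤ max(2/γ_D, 2γ′⁻¹)`, uniformly in `n`, `M`.

ROLE.  The W1 ⊤-witness for the owner's star-bond vector region tower (O13-a) — the analogue of gen 11's ⊤-witness
`DirichletFreeTowerTop` for the injected law `hinj`.  It says NOTHING about `S ≠ ⊤`: the located open estimate («`c` uniform in the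
region», memo §6) stays OPEN.

HONEST FRAMING (T4-DAG p. 1).  Model level (`U = 1`, one averaging scale, finite torus, operator norm); [folklore] finite-dimensional
algebra over landed modules; `[cite:]` tags locate SHAPES and the printed sentences quoted above; at `S = ⊤` this is B5 (1.90) re-read on
the slice, NOT a region estimate, NOT [B9] (3.23)–(3.27) as printed; NE2 (U1a) NOT proved; spine 0/9 unchanged; NOT infinite volume / mass
gap / Clay / summit progress.  HONEST DEPENDENCY: continuum YM on T⁴ ⇐ BetaPertH ∧ nine spine estimates (0/9 proved); BetaPertH ⇐ (D1) ∧
(D4) ∧ CAP+tail; G-an2-4 gates asym, D1 and NE2/3/4.  No `sorry`.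
-/

noncomputable section

open scoped BigOperators ComplexConjugate Matrix Matrix.Norms.L2Operator
open Finset

namespace Summit.QuantumFields.BalabanUV.T4Continuum.RegionGaugeSliceTorus

open Literature.MathematicalPhysics.QuantumFieldTheory.Balaban1983to89.B5Prop11Plancherel (Tor fine)
open Literature.MathematicalPhysics.QuantumFieldTheory.Balaban1983to89.B5Prop11Lower (nsq nsq_nonneg star_dotProduct_self)
open Literature.MathematicalPhysics.QuantumFieldTheory.Balaban1983to89.B5Prop11Inverse (calDa)
open Literature.MathematicalPhysics.QuantumFieldTheory.Balaban1983to89.B5Action121 (LapS GradOp CurlOp)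
open Literature.MathematicalPhysics.QuantumFieldTheory.Balaban1983to89.B5Block118 (QsOp QvOp)
open Literature.MathematicalPhysics.QuantumFieldTheory.Balaban1983to89.B5LaplaceInverse (LapSinv LapSinv_LapS_of_orth)
open Literature.MathematicalPhysics.QuantumFieldTheory.Balaban1983to89.B5Substitution125 (Mop Minv Mop_mulVec Minv_Mop_of_orth
  sum_QsOp_adjoint)
open Literature.MathematicalPhysics.QuantumFieldTheory.Balaban1983to89.B5Value126 (PcT PcT_mulVec)
open Literature.MathematicalPhysics.QuantumFieldTheory.Balaban1983to89.B5DivOrth (sum_GradOp_adjoint sum_LapS)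
open Literature.MathematicalPhysics.QuantumFieldTheory.Balaban1983to89.B5DeltaA169 (DeltaA QvAdj calDa_eq_DeltaA DeltaA_eq_curl)
open Summit.QuantumFields.BalabanUV.T4Continuum
open Summit.QuantumFields.BalabanUV.T4Continuum.SubtypeCompression (Coercive ext ext_apply_of ext_apply_of_not nsq_ext toBlock_mulVec
  toBlock_conjTranspose)
open Summit.QuantumFields.BalabanUV.T4Continuum.ScalarBlockPoincare (PiS nsq_smul)
open Summit.QuantumFields.BalabanUV.T4Continuum.ScalarAveragedPropagator (DeltaPs gammaPs gammaPs_pos)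
open Summit.QuantumFields.BalabanUV.T4Continuum.RegionGaugeProjection (gramK gaugeP gaugeR)
open Summit.QuantumFields.BalabanUV.T4Continuum.RegionGaugeSlice (SliceCoercive coercive_gaugeFixed_of_slice form_gram)
open Summit.QuantumFields.BalabanUV.T4Continuum.RegionScalarCompression (QOm GOm DOm_mul_GOm)
open Summit.QuantumFields.BalabanUV.T4Continuum.RegionGaugeFixedVector (starReg curlR gradR avgR regionDeltaA sliceData_region
  opNorm_inv_regionDeltaA_le_of_slice isUnit_det_regionDeltaA_of_slice)
open Summit.QuantumFields.BalabanUV.T4Continuum.RegionGaugeFixedVectorFlat (submatrix_mulVec_eq avgR_mulVec)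
open Summit.QuantumFields.BalabanUV.T4Continuum.DirichletRegionTower (gamD gamD_pos coercive_calDa)
open Summit.QuantumFields.BalabanUV.Beta.GAN24.DirichletBoxCompression (DOm opNorm_inv_DOm_le toBlock_mulVec')
open Summit.QuantumFields.BalabanUV.Beta.GAN24.DirichletBoxTrace (blockReg)

variable {d : ℕ}

/-! ## §1 Generic bookkeeping: restriction along an everywhere-true predicate -/

section Generic

variable {m : Type*}

/-- along an everywhere-true predicate, «restrict then extend by zero» is the identity. [folklore] -/
theorem ext_restrict_of_forall (p : m → Prop) [DecidablePred p] (hp : ∀ x, p x) (u : m → ℂ) :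
    ext p (fun a : {a // p a} => u a) = u := by
  funext i
  exact ext_apply_of p (fun a : {a // p a} => u a) ⟨i, hp i⟩

/-- along an everywhere-true predicate, two fields with equal restrictions are equal. [folklore] -/
theorem eq_of_restrict_eq (p : m → Prop) (hp : ∀ x, p x) {u v : m → ℂ}
    (h : (fun a : {a // p a} => u a) = fun a : {a // p a} => v a) : u = v := by
  funext i
  exact congrFun h ⟨i, hp i⟩

end Generic

/-! ## §2 The key torus lemma: B5's co-projection `P` fixes every mean-zero scalar whose Laplacian is block-constant -/

section Torus

variable (n : ℕ) [NeZero n] (M : Fin d → ℕ) [hM : ∀ μ, NeZero (M μ)]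

/-- **KEY TORUS LEMMA**: if `f ⊥ 1` and `Δf = Q′ᴴν` then `P f = f` for B5's `P = Δ⁻¹Q′*(Q′Δ⁻²Q′*)⁻¹Q′Δ⁻¹` — indeed `ν ⊥ 1`
(`Δf ⊥ 1`), `f = Δ⁻¹Q′ᴴν`, so `Q′Δ⁻¹f = (Q′Δ⁻²Q′*)ν` and `(Q′Δ⁻²Q′*)⁻¹` undoes it on mean-zero `ν`.
[cite: Balaban1984PropagatorsI, (1.70) p.30 (shape: the formula for P on ∂*A ⊥ 1)] [folklore] -/
theorem PcT_mulVec_eq_self {c : ℂ} (hc : c ≠ 0) (f : Tor (fine n M) → ℂ) (hf : ∑ x, f x = 0) (ν : Tor M → ℂ)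
    (hL : LapS (fine n M) c *ᵥ f = (QsOp n M)ᴴ *ᵥ ν) : PcT n M c *ᵥ f = f := by
  -- `ν ⊥ 1`
  have hν : ∑ y, ν y = 0 := by
    rw [← sum_QsOp_adjoint n M ν, ← hL]
    exact sum_LapS (fine n M) c f
  -- `f = Δ⁻¹Q′ᴴν`
  have hf1 : f = LapSinv (fine n M) c *ᵥ ((QsOp n M)ᴴ *ᵥ ν) := by
    conv_lhs => rw [← LapSinv_LapS_of_orth (fine n M) hc f hf, hL]
  rw [PcT_mulVec]
  conv_lhs => rw [hf1]
  rw [← Mop_mulVec, Minv_Mop_of_orth n M c hc ν hν, ← hf1]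

end Torus

/-! ## §2b The slice algebra: `R·f = 0` puts `f` in `G′·range Q′ᴴ` -/

section Slice

variable {m u : Type*} [Fintype m] [DecidableEq m] [Fintype u] [DecidableEq u]

/-- **`R f = 0 ⟹ f = G′Q′ᴴμ`** with the explicit `μ = (Q′G′²Q′ᴴ)⁻¹Q′G′f` (unfolding `R = 1 − G′Q′ᴴ(Q′G′²Q′ᴴ)⁻¹Q′G′`, (3.25)).
[cite: Balaban1985BackgroundPropagators, (3.25) p.395 (shape)] [folklore] -/
theorem eq_G_QH_of_gaugeR_eq_zero (G : Matrix m m ℂ) (Q : Matrix u m ℂ) (f : m → ℂ) (h : gaugeR G Q *ᵥ f = 0) :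
    f = G *ᵥ (Qᴴ *ᵥ ((gramK G Q)⁻¹ *ᵥ (Q *ᵥ (G *ᵥ f)))) := by
  rw [gaugeR, Matrix.sub_mulVec, Matrix.one_mulVec, sub_eq_zero, gaugeP] at h
  simpa only [← Matrix.mulVec_mulVec] using h

end Slice

/-! ## §3 The region objects of the whole torus versus the torus objects -/

section Top

variable (n : ℕ) [NeZero n] (M : Fin d → ℕ) [hM : ∀ μ, NeZero (M μ)] (a a' : ℝ) (S : Tor M → Prop) [DecidablePred S]

/-- every fine site lies in the region of `⊤`. [folklore] -/
theorem blockReg_topU (x : Tor (fine n M)) : blockReg n M (fun _ : Tor M => True) x := trivial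

/-- every bond is a star bond of `⊤`. [folklore] -/
theorem starReg_topU (b : Tor (fine n M) × Fin d) : starReg n M (fun _ : Tor M => True) b := by
  unfold starReg
  exact Or.inl (blockReg_topU n M b.1)

/-- the region curl acts on the zero-extension as `2^{−1/2}·Curl` (any region). [folklore] -/
theorem curlR_mulVec (A' : {b // starReg n M S b} → ℂ) :
    curlR n M S *ᵥ A' = (((Real.sqrt 2)⁻¹ : ℝ) : ℂ) • (CurlOp (fine n M) (n : ℂ) *ᵥ ext (starReg n M S) A') := by
  rw [curlR, Matrix.smul_mulVec, submatrix_mulVec_eq]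

/-- the region divergence is the torus divergence of the zero-extension, read on the region (any region). [folklore] -/
theorem gradR_conjTranspose_mulVec (A' : {b // starReg n M S b} → ℂ) :
    (gradR n M S)ᴴ *ᵥ A' = fun x : {x // blockReg n M S x} => ((GradOp (fine n M) (n : ℂ))ᴴ *ᵥ ext (starReg n M S) A') x := by
  rw [gradR, toBlock_conjTranspose, toBlock_mulVec']

/-- `‖curlR A′‖² = ½‖Curl ιA′‖²` (any region). [folklore] -/
theorem nsq_curlR_mulVec (A' : {b // starReg n M S b} → ℂ) :
    nsq (curlR n M S *ᵥ A') = (1 / 2) * nsq (CurlOp (fine n M) (n : ℂ) *ᵥ ext (starReg n M S) A') := by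
  rw [curlR_mulVec, nsq_smul, Complex.norm_real, Real.norm_of_nonneg (by positivity), inv_pow,
    Real.sq_sqrt (by norm_num : (0:ℝ) ≤ 2), one_div]

/-- at `S = ⊤` the region divergence extends (by nothing) to the torus divergence. [folklore] -/
theorem ext_gradR_conjTranspose_mulVec_top (A' : {b // starReg n M (fun _ : Tor M => True) b} → ℂ) :
    ext (blockReg n M (fun _ : Tor M => True)) ((gradR n M (fun _ : Tor M => True))ᴴ *ᵥ A')
      = (GradOp (fine n M) (n : ℂ))ᴴ *ᵥ ext (starReg n M (fun _ : Tor M => True)) A' := by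
  rw [gradR_conjTranspose_mulVec]
  exact ext_restrict_of_forall (blockReg n M (fun _ : Tor M => True)) (blockReg_topU n M) _

/-- **ON BAŁABAN's SLICE OF THE WHOLE TORUS, B5's CO-PROJECTION FIXES THE FIELD**: for a scalar `f` on the `⊤`-region with `ιf ⊥ 1` and
`R(⊤)·f = 0` one has `P(ιf) = ιf`.  Proof: `f = G′Q′ᴴμ` (§2b) ⟹ `Δ′_a f = Q′ᴴμ` (`Δ′_aG′ = 1`) ⟹ `Δ(ιf) = Q′ᴴ(μ − a′n^d·Q′ιf)`
(`Δ′_a = Δ + a′Π′`, `Π′ = n^dQ′ᴴQ′`) ⟹ §2. [cite: Balaban1984PropagatorsI, (1.70) p.30 (shape)] [folklore] -/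
theorem PcT_ext_eq_self_of_gaugeR_eq_zero (ha' : 0 < a') (f : {x // blockReg n M (fun _ : Tor M => True) x} → ℂ)
    (hf : ∑ x, ext (blockReg n M (fun _ : Tor M => True)) f x = 0)
    (hR : gaugeR (GOm n M a' (fun _ : Tor M => True)) (QOm n M (fun _ : Tor M => True)) *ᵥ f = 0) :
    PcT n M (n : ℂ) *ᵥ ext (blockReg n M (fun _ : Tor M => True)) f = ext (blockReg n M (fun _ : Tor M => True)) f := by
  have e := eq_G_QH_of_gaugeR_eq_zero _ _ _ hR
  -- apply `Δ′_a↾⊤` to `f = G′Q′ᴴμ`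
  have hD : DOm n M a' (blockReg n M (fun _ : Tor M => True)) *ᵥ (GOm n M a' (fun _ : Tor M => True) *ᵥ ((QOm n M (fun _ : Tor M => True))ᴴ *ᵥ
      ((gramK (GOm n M a' (fun _ : Tor M => True)) (QOm n M (fun _ : Tor M => True)))⁻¹ *ᵥ (QOm n M (fun _ : Tor M => True) *ᵥ (GOm n M a' (fun _ : Tor M => True) *ᵥ f)))))
      = (QOm n M (fun _ : Tor M => True))ᴴ *ᵥ ((gramK (GOm n M a' (fun _ : Tor M => True)) (QOm n M (fun _ : Tor M => True)))⁻¹ *ᵥ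
          (QOm n M (fun _ : Tor M => True) *ᵥ (GOm n M a' (fun _ : Tor M => True) *ᵥ f))) := by
    rw [Matrix.mulVec_mulVec, DOm_mul_GOm n M a' (fun _ : Tor M => True) ha', Matrix.one_mulVec]
  rw [← e] at hD
  -- read both sides on the torus
  have h1 : DOm n M a' (blockReg n M (fun _ : Tor M => True)) *ᵥ f
      = fun x : {x // blockReg n M (fun _ : Tor M => True) x} => (DeltaPs n M a' *ᵥ ext (blockReg n M (fun _ : Tor M => True)) f) x := by
    rw [DOm, toBlock_mulVec]
  have h2 : (QOm n M (fun _ : Tor M => True))ᴴ *ᵥ ((gramK (GOm n M a' (fun _ : Tor M => True)) (QOm n M (fun _ : Tor M => True)))⁻¹ *ᵥ (QOm n M (fun _ : Tor M => True) *ᵥ (GOm n M a' (fun _ : Tor M => True) *ᵥ f)))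
      = fun x : {x // blockReg n M (fun _ : Tor M => True) x} => ((QsOp n M)ᴴ *ᵥ ext (fun _ : Tor M => True)
          ((gramK (GOm n M a' (fun _ : Tor M => True)) (QOm n M (fun _ : Tor M => True)))⁻¹ *ᵥ (QOm n M (fun _ : Tor M => True) *ᵥ (GOm n M a' (fun _ : Tor M => True) *ᵥ f)))) x := by
    rw [QOm, toBlock_conjTranspose, toBlock_mulVec']
  have hD' := eq_of_restrict_eq _ (blockReg_topU n M) (h1.symm.trans (hD.trans h2))
  -- `Δ(ιf) = Q′ᴴν`
  rw [DeltaPs, Matrix.add_mulVec, Matrix.smul_mulVec, PiS, Matrix.smul_mulVec, ← Matrix.mulVec_mulVec, smul_smul] at hD'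
  have hL : LapS (fine n M) (n : ℂ) *ᵥ ext (blockReg n M (fun _ : Tor M => True)) f
      = (QsOp n M)ᴴ *ᵥ (ext (fun _ : Tor M => True) ((gramK (GOm n M a' (fun _ : Tor M => True)) (QOm n M (fun _ : Tor M => True)))⁻¹ *ᵥ (QOm n M (fun _ : Tor M => True) *ᵥ (GOm n M a' (fun _ : Tor M => True) *ᵥ f)))
          - ((a' : ℂ) * (n : ℂ) ^ d) • (QsOp n M *ᵥ ext (blockReg n M (fun _ : Tor M => True)) f)) := by
    rw [Matrix.mulVec_sub, Matrix.mulVec_smul, ← hD', add_sub_cancel_right]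
  exact PcT_mulVec_eq_self n M (by exact_mod_cast NeZero.ne n) _ hf _ hL

/-- **IN PARTICULAR `P` FIXES THE DIVERGENCE OF EVERY FIELD ON THE SLICE OF THE WHOLE TORUS**: `R(⊤)·∂*A′ = 0 ⟹ P(∂ᴴιA′) = ∂ᴴιA′`
(`∂ᴴιA′ ⊥ 1` always, `B5DivOrth.sum_GradOp_adjoint`). [cite: Balaban1984PropagatorsI, (1.70) p.30 (shape)] [folklore] -/
theorem PcT_divergence_top (ha' : 0 < a') (A' : {b // starReg n M (fun _ : Tor M => True) b} → ℂ)
    (hA' : gaugeR (GOm n M a' (fun _ : Tor M => True)) (QOm n M (fun _ : Tor M => True)) *ᵥ ((gradR n M (fun _ : Tor M => True))ᴴ *ᵥ A') = 0) :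
    PcT n M (n : ℂ) *ᵥ ((GradOp (fine n M) (n : ℂ))ᴴ *ᵥ ext (starReg n M (fun _ : Tor M => True)) A')
      = (GradOp (fine n M) (n : ℂ))ᴴ *ᵥ ext (starReg n M (fun _ : Tor M => True)) A' := by
  rw [← ext_gradR_conjTranspose_mulVec_top]
  refine PcT_ext_eq_self_of_gaugeR_eq_zero n M a' ha' _ ?_ hA'
  rw [ext_gradR_conjTranspose_mulVec_top]
  exact sum_GradOp_adjoint (fine n M) (n : ℂ) _

/-- **THE FORM OF B5's `Δ_a` WHEN `P` FIXES THE DIVERGENCE**: `Re⟨B, Δ_a B⟩ = ½‖Curl B‖² + a n^d‖QB‖²` (the middle term of (1.69)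
«⟨A, ∂R∂*A⟩», `R = I − P`, vanishes). [cite: Balaban1984PropagatorsI, (1.69) p.29 (shape)] [folklore] -/
theorem re_form_DeltaA_of_PcT (B : Tor (fine n M) × Fin d → ℂ)
    (hB : PcT n M (n : ℂ) *ᵥ ((GradOp (fine n M) (n : ℂ))ᴴ *ᵥ B) = (GradOp (fine n M) (n : ℂ))ᴴ *ᵥ B) :
    (star B ⬝ᵥ (DeltaA n M a *ᵥ B)).re
      = (1 / 2) * nsq (CurlOp (fine n M) (n : ℂ) *ᵥ B) + a * (n : ℝ) ^ d * nsq (QvOp n M *ᵥ B) := by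
  have hmid : (GradOp (fine n M) (n : ℂ) * (1 - PcT n M (n : ℂ)) * (GradOp (fine n M) (n : ℂ))ᴴ) *ᵥ B = 0 := by
    rw [← Matrix.mulVec_mulVec, ← Matrix.mulVec_mulVec, Matrix.sub_mulVec, Matrix.one_mulVec, hB, sub_self,
      Matrix.mulVec_zero]
  have e : star B ⬝ᵥ (DeltaA n M a *ᵥ B)
      = (((1 / 2) * nsq (CurlOp (fine n M) (n : ℂ) *ᵥ B) + a * (n : ℝ) ^ d * nsq (QvOp n M *ᵥ B) : ℝ) : ℂ) := by
    rw [DeltaA_eq_curl, Matrix.add_mulVec, Matrix.add_mulVec, hmid, add_zero, QvAdj, Matrix.smul_mul, smul_smul,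
      Matrix.smul_mulVec, Matrix.smul_mulVec, dotProduct_add, dotProduct_smul, dotProduct_smul, form_gram, form_gram,
      smul_eq_mul, smul_eq_mul]
    push_cast
    ring
  rw [e, Complex.ofReal_re]

/-! ## §4 END: slice coercivity on the whole torus with B5's constant, and the coercivity of `Δ_a(⊤)` -/

/-- **THE ⊤-WITNESS OF THE SLICE INEQUALITY**: on the whole torus Bałaban's slice coercivity HOLDS with the constant
`γ_D = ((d+1)·Cst(d,a))⁻¹` of B5 (1.90) (tree kernel version), UNIFORMLY in `n = η⁻¹` and the torus `M`:
for every `A′` with `R(⊤)·∂*A′ = 0`, `γ_D‖A′‖² ≤ ‖curlR A′‖² + a n^d‖QA′‖²`.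
[cite: Balaban1984PropagatorsI, Prop. 1.1 (1.90) p.33 (kernel version of the tree, read on the slice; constant ours)] [folklore] -/
theorem sliceCoercive_top (hn : 1 ≤ n) (ha : 0 < a) (ha' : 0 < a') :
    SliceCoercive (curlR n M (fun _ : Tor M => True)) (gradR n M (fun _ : Tor M => True)) (GOm n M a' (fun _ : Tor M => True)) (QOm n M (fun _ : Tor M => True)) (avgR n M (fun _ : Tor M => True))
      (a * (n : ℝ) ^ d) (gamD d a) := by
  intro A' hA'
  have hco := coercive_calDa M a ha n hn (ext (starReg n M (fun _ : Tor M => True)) A')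
  rw [calDa_eq_DeltaA n hn M a ha, nsq_ext, re_form_DeltaA_of_PcT n M a _ (PcT_divergence_top n M a' ha' A' hA')] at hco
  rw [nsq_curlR_mulVec, avgR_mulVec]
  exact hco

/-- **HENCE THE FAITHFUL REGION OPERATOR OF THE WHOLE TORUS IS COERCIVE** with `min(γ_D/2, γ′/2)` (`γ′ = gammaPs d a′`), uniformly in
`n`, `M` — gen 5's reduction `coercive_gaugeFixed_of_slice` BY NAME. [cite: Balaban1985BackgroundPropagators, (3.27) p.395 (shape)] [folklore] -/
theorem coercive_regionDeltaA_top (hn : 1 ≤ n) (ha : 0 < a) (ha' : 0 < a') :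
    Coercive (regionDeltaA n M a a' (fun _ : Tor M => True)) (min (gamD d a / 2) (1 / (2 * (gammaPs d a')⁻¹))) :=
  coercive_gaugeFixed_of_slice _ (sliceData_region n M a' (fun _ : Tor M => True) ha') (gamD_pos a) (sliceCoercive_top n M a a' hn ha ha')
    (opNorm_inv_DOm_le n M a' (blockReg n M (fun _ : Tor M => True)) ha') (inv_pos.mpr (gammaPs_pos (d := d) (a' := a')).1)

/-- «`G(⊤)` exists» … [cite: Balaban1985BackgroundPropagators, (3.27) p.395 (shape)] [folklore] -/
theorem isUnit_det_regionDeltaA_top (hn : 1 ≤ n) (ha : 0 < a) (ha' : 0 < a') :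
    IsUnit (regionDeltaA n M a a' (fun _ : Tor M => True)).det :=
  isUnit_det_regionDeltaA_of_slice n M a a' (fun _ : Tor M => True) ha' (gamD_pos a) (sliceCoercive_top n M a a' hn ha ha')

/-- **… with `‖G(⊤)‖ ≤ max(2/γ_D, 2γ′⁻¹)`**, uniformly in `n`, `M`. [cite: Balaban1985BackgroundPropagators, (3.27) p.395 (shape)] [folklore] -/
theorem opNorm_inv_regionDeltaA_top_le (hn : 1 ≤ n) (ha : 0 < a) (ha' : 0 < a') :
    ‖(regionDeltaA n M a a' (fun _ : Tor M => True))⁻¹‖ ≤ (min (gamD d a / 2) (1 / (2 * (gammaPs d a')⁻¹)))⁻¹ :=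
  opNorm_inv_regionDeltaA_le_of_slice n M a a' (fun _ : Tor M => True) ha' (gamD_pos a) (sliceCoercive_top n M a a' hn ha ha')

end Top

end Summit.QuantumFields.BalabanUV.T4Continuum.RegionGaugeSliceTorus

end
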